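import Summits.CriticalPhenomena.CardyFormulaZ2.Theses.CardyMagicRigidity
import Literature.Probability.Percolation.CardyFormulaConformalInvariance
import Literature.Probability.Percolation.BoxCrossingUpperBound
import Literature.Probability.Percolation.ZdNearCriticalWindow
import Literature.Probability.Percolation.HalfSpacePinnedPairs
import Literature.Probability.Percolation.SharpnessDCTProofs
import Literature.Probability.RandomPlanarGeometry.ConformalRectangleProofs
import Literature.Probability.RandomPlanarGeometry.ModulusSymmetry
import Literature.Probability.RandomPlanarGeometry.CardyFunctionIncBeta
import Literature.Probability.RandomPlanarGeometry.ArcHullDomains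

/-!
# Cyclic shift of the marking flips the Cardy value (line `oracle-sandwich`, stub D3)

Crux `Summit.CriticalPhenomena.CardyFormulaZ2.Theses.CardyMagicRigidity.LoopsToCrossings`
(stmt-CriticalPhenomena-4837), line `oracle-sandwich`, stub `stub_cyclicFlip` (D3, X-free Möbius
bookkeeping).

Every conformal rectangle `R = (Ω; P₀, P₁, P₂, P₃)` (boundary loop `γ = R.boundary`, marks
`m₀ < m₁ < m₂ < m₃ < m₀ + 1` in `[0,1)`) has a re-parametrised, cyclically re-marked copy
`R₂ = (Ω; P₁, P₂, P₃, P₀)`: the same carrier, the shifted loop `u ↦ γ (u + m₁)` (continuous,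
`1`-periodic, injective on `[0,1)` by `Function.Periodic.injOn_shift`, same range by
`range_comp_add_right`) and the marks `(0, m₂ - m₁, m₃ - m₁, m₀ + 1 - m₁)`, so that
`R₂.pt i = R.pt (i + 1)`.  For all uniformizing data `(φ, x)` of `R` and `(φ₂, x₂)` of `R₂`,
`F(η(x₂)) = 1 - F(η(x))`: the map `φ₂ : ℍₒ → Ω` has boundary values `P₀, P₁, P₂, P₃` at the
cyclically rotated tuple `(x₂ 3, x₂ 0, x₂ 1, x₂ 2)`, which is monotone up to the position of `∞`;
the real Möbius map `z ↦ c - 1/z` renormalises it to a genuine uniformizing datum of `R`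
(`ConformalRectangle.exists_isUniformizing_of_cyclic`) with the same cross-ratio
`η(x₂ 3, x₂ 0, x₂ 1, x₂ 2) = 1 - η(x₂)` (`crossRatio_perm_3012`), and conformal invariance of the
cross-ratio (`ConformalRectangle.crossRatio_eq_of_isUniformizing_holds`) gives `η(x) = 1 - η(x₂)`;
finally `F(1 - η) = 1 - F(η)` (`cardyFunction_one_sub_holds`).

Sources: L. V. Ahlfors, *Complex Analysis* (1979), Ch. 3 §3.1 (cross-ratio) and Ch. 6 §1.1;
V. Beffara, *Is critical 2D percolation universal?* (2008), proof of Prop. 4, arXiv:0708.3908.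
-/

noncomputable section

namespace Summit.CriticalPhenomena.CardyFormulaZ2.Cruxes.LoopsToCrossings.OracleSandwich

open Summit.CriticalPhenomena.CardyFormulaZ2.Theses.CardyMagicRigidity
open Literature.Probability.RandomPlanarGeometry hiding cardyFunction
open Literature.Probability.Percolation hiding cardyFunction
open Literature.Probability.LatticeModels
open Filter Topology Set MeasureTheory Metric
open UpperHalfPlane (upperHalfPlaneSet)

/-- The cross-ratio of the cyclically rotated tuple `(x₃, x₀, x₁, x₂)` of four points with
`x₀ ≠ x₂`, `x₁ ≠ x₃` is `1 - crossRatio x` (the identity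
`(x₀ - x₁)(x₂ - x₃) + (x₀ - x₃)(x₁ - x₂) = (x₀ - x₂)(x₁ - x₃)`; companion of `crossRatio_perm_0321`).
Ahlfors (1979), Ch. 3 §3.1. [cite: Ahlfors1979, Ch. 3 §3.1] -/
theorem crossRatio_perm_3012 (x : Fin 4 → ℝ) (h02 : x 0 ≠ x 2) (h13 : x 1 ≠ x 3) :
    crossRatio ![x 3, x 0, x 1, x 2] = 1 - crossRatio x := by
  have ha : x 0 - x 2 ≠ 0 := sub_ne_zero.2 h02
  have hb : x 1 - x 3 ≠ 0 := sub_ne_zero.2 h13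
  have hc : x 3 - x 1 ≠ 0 := sub_ne_zero.2 (Ne.symm h13)
  unfold crossRatio
  simp only [Matrix.cons_val_zero, Matrix.cons_val_one, Matrix.cons_val]
  field_simp
  ring

/-- **Möbius bookkeeping for the cyclic re-marking.** Let `(φ, x)` be a uniformizing datum of the
conformal rectangle `R = (Ω; P₀, P₁, P₂, P₃)` and let `ψ : ℍₒ → Ω` be a conformal equivalence with
boundary values `P₁, P₂, P₃, P₀` at a strictly monotone (or antitone) real tuple `z₀, z₁, z₂, z₃`
(i.e. a uniformizing datum of the re-marked rectangle `(Ω; P₁, P₂, P₃, P₀)`). Then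
`crossRatio z = 1 - crossRatio x`: `ψ` has boundary values `P₀, P₁, P₂, P₃` at the cyclically
rotated tuple `(z₃, z₀, z₁, z₂)`, which the Möbius map `w ↦ c - 1/w` renormalises to a genuine
uniformizing datum of `R` (`ConformalRectangle.exists_isUniformizing_of_cyclic`) with cross-ratio
`crossRatio (z₃, z₀, z₁, z₂) = 1 - crossRatio z` (`crossRatio_perm_3012`), and the cross-ratio of
a uniformizing datum of `R` does not depend on the datum
(`ConformalRectangle.crossRatio_eq_of_isUniformizing_holds`). Ahlfors (1979), Ch. 3 §3.1 and
Ch. 6 §1.1; Beffara (2008), proof of Prop. 4. [cite: Ahlfors1979, Ch. 3 §3.1 and Ch. 6 §1.1] -/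
theorem crossRatio_eq_one_sub_of_cyclic_boundaryValues (R : ConformalRectangle)
    {φ : ConformalEquiv upperHalfPlaneSet R.carrier} {x : Fin 4 → ℝ} (h : R.IsUniformizing φ x)
    (ψ : ConformalEquiv upperHalfPlaneSet R.carrier) {z : Fin 4 → ℝ}
    (hz : StrictMono z ∨ StrictAnti z) {p : Fin 4 → ℂ}
    (hbv : ∀ i, ψ.HasBoundaryValue (z i) (p i))
    (h0 : p 0 = R.pt 1) (h1 : p 1 = R.pt 2) (h2 : p 2 = R.pt 3) (h3 : p 3 = R.pt 0) :
    crossRatio z = 1 - crossRatio x := by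
  set y : Fin 4 → ℝ := ![z 3, z 0, z 1, z 2] with hy
  -- boundary values of `ψ` for the ORIGINAL marking of `R`, at the rotated tuple `y`
  have hby : ∀ i, ψ.HasBoundaryValue (y i) (R.pt i) := by
    have e0 := hbv 0; have e1 := hbv 1; have e2 := hbv 2; have e3 := hbv 3
    rw [h0] at e0; rw [h1] at e1; rw [h2] at e2; rw [h3] at e3
    intro i
    fin_cases i
    · simpa [hy] using e3
    · simpa [hy] using e0
    · simpa [hy] using e1
    · simpa [hy] using e2
  have h01 : (0 : Fin 4) < 1 := by decide
  have h12 : (1 : Fin 4) < 2 := by decide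
  have h23 : (2 : Fin 4) < 3 := by decide
  -- `y` is increasing only cyclically: `y₁ < y₂ < y₃ < y₀` (or the reverse pattern)
  have hcyc : (y 1 < y 2 ∧ y 2 < y 3 ∧ y 3 < y 0) ∨ (y 0 < y 3 ∧ y 3 < y 2 ∧ y 2 < y 1) := by
    rcases hz with hm | hm
    · left
      have a := hm h01; have b := hm h12; have c := hm h23
      simp only [hy, Matrix.cons_val_zero, Matrix.cons_val_one, Matrix.cons_val]
      exact ⟨a, b, c⟩
    · right
      have a := hm h01; have b := hm h12; have c := hm h23
      simp only [hy, Matrix.cons_val_zero, Matrix.cons_val_one, Matrix.cons_val]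
      exact ⟨c, b, a⟩
  -- Möbius renormalisation to a genuine uniformizing datum of `R`, same cross-ratio
  obtain ⟨φ', x', hux', hcr'⟩ := R.exists_isUniformizing_of_cyclic ψ y hby hcyc
  -- conformal invariance of the cross-ratio
  have hwd : crossRatio x' = crossRatio x :=
    ConformalRectangle.crossRatio_eq_of_isUniformizing_holds hux' h
  have hinj : Function.Injective z := hz.elim StrictMono.injective StrictAnti.injective
  have hz02 : z 0 ≠ z 2 := fun e ↦ by simpa using hinj e
  have hz13 : z 1 ≠ z 3 := fun e ↦ by simpa using hinj e
  have key : crossRatio y = 1 - crossRatio z := by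
    rw [hy]; exact crossRatio_perm_3012 z hz02 hz13
  rw [← hwd, hcr', key]
  ring

/-- **Stub D3 — cyclic shift of the marking flips the Cardy value** (X-free; Möbius bookkeeping, all
inputs in the tree).  Every conformal rectangle `R = (Ω; P₀, P₁, P₂, P₃)` has a re-parametrised,
cyclically re-marked copy `R₂ = (Ω; P₁, P₂, P₃, P₀)`: same carrier, boundary loop
`u ↦ R.boundary (u + R.mark 1)` (still continuous, `1`-periodic, injective on `[0,1)`, same range),
marks `(0, m₂ - m₁, m₃ - m₁, m₀ + 1 - m₁) ∈ [0,1)` increasing (`MarkedDomain.marks_chain`); and for all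
uniformizing data, `F(η(R₂)) = 1 - F(η(R))`: a uniformizing map of `R₂` with boundary tuple
`(x₀, x₁, x₂, x₃)` uniformizes `R` with the cyclically rotated tuple `(x₃, x₀, x₁, x₂)`, which a
real Möbius map renormalises to a monotone one (`ConformalRectangle.exists_isUniformizing_of_cyclic`)
with cross-ratio `1 - η` (`crossRatio_perm_3012`, `crossRatio_inv`), independent of the datum
(`crossRatio_eq_of_isUniformizing_holds`); then `cardyFunction_one_sub_holds`.  Ahlfors (1979),
Ch. 3 §3.1 and Ch. 6 §1.1; Beffara (2008), proof of Prop. 4.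
[cite: Ahlfors1979, Ch. 3 §3.1 and Ch. 6 §1.1] -/
theorem stub_cyclicFlip :
    ∀ R : ConformalRectangle, ∃ R₂ : ConformalRectangle, R₂.carrier = R.carrier ∧
      (∀ u : ℝ, R₂.boundary u = R.boundary (u + R.mark 1)) ∧
      (∀ i : Fin 4, R₂.mark i = ![0, R.mark 2 - R.mark 1, R.mark 3 - R.mark 1, R.mark 0 + 1 - R.mark 1] i) ∧
      ∀ (φ : ConformalEquiv UpperHalfPlane.upperHalfPlaneSet R.carrier) (x : Fin 4 → ℝ)
        (φ₂ : ConformalEquiv UpperHalfPlane.upperHalfPlaneSet R₂.carrier) (x₂ : Fin 4 → ℝ),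
        R.IsUniformizing φ x → R₂.IsUniformizing φ₂ x₂ →
        Literature.Probability.RandomPlanarGeometry.cardyFunction (crossRatio x₂) =
          1 - Literature.Probability.RandomPlanarGeometry.cardyFunction (crossRatio x) := by
  intro R
  obtain ⟨hm0, hm01, hm12, hm23, hm30⟩ := R.marks_chain
  have hm1 : R.mark 1 < 1 := (R.mark_mem 1).2
  -- the re-parametrised, cyclically re-marked copy `R₂ = (Ω; P₁, P₂, P₃, P₀)` (same carrier)
  let R₂ : ConformalRectangle :=
    { carrier := R.carrier
      boundary := fun u ↦ R.boundary (u + R.mark 1)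
      isOpen := R.isOpen
      isBounded := R.isBounded
      isConnected := R.isConnected
      continuous_boundary := R.continuous_boundary.comp (continuous_id.add continuous_const)
      periodic_boundary := fun u ↦ by
        show R.boundary (u + 1 + R.mark 1) = R.boundary (u + R.mark 1)
        rw [add_right_comm]
        exact R.periodic_boundary _
      injOn_boundary := R.periodic_boundary.injOn_shift R.injOn_boundary _
      range_boundary := by rw [range_comp_add_right R.boundary (R.mark 1), R.range_boundary]
      mark := ![0, R.mark 2 - R.mark 1, R.mark 3 - R.mark 1, R.mark 0 + 1 - R.mark 1]
      strictMono_mark := by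
        refine Fin.strictMono_iff_lt_succ.2 fun k ↦ ?_
        fin_cases k
        · show (0 : ℝ) < R.mark 2 - R.mark 1
          linarith
        · show R.mark 2 - R.mark 1 < R.mark 3 - R.mark 1
          linarith
        · show R.mark 3 - R.mark 1 < R.mark 0 + 1 - R.mark 1
          linarith
      mark_mem := fun k ↦ by
        fin_cases k
        · show (0 : ℝ) ∈ Ico 0 1
          simp
        · show R.mark 2 - R.mark 1 ∈ Ico 0 1
          constructor <;> linarith
        · show R.mark 3 - R.mark 1 ∈ Ico 0 1
          constructor <;> linarith
        · show R.mark 0 + 1 - R.mark 1 ∈ Ico 0 1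
          constructor <;> linarith }
  -- its marked points: `R₂.pt i = R.pt (i + 1)`
  have hp0 : R₂.pt 0 = R.pt 1 := by
    show R.boundary (0 + R.mark 1) = R.boundary (R.mark 1)
    rw [zero_add]
  have hp1 : R₂.pt 1 = R.pt 2 := by
    show R.boundary (R.mark 2 - R.mark 1 + R.mark 1) = R.boundary (R.mark 2)
    rw [sub_add_cancel]
  have hp2 : R₂.pt 2 = R.pt 3 := by
    show R.boundary (R.mark 3 - R.mark 1 + R.mark 1) = R.boundary (R.mark 3)
    rw [sub_add_cancel]
  have hp3 : R₂.pt 3 = R.pt 0 := by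
    show R.boundary (R.mark 0 + 1 - R.mark 1 + R.mark 1) = R.boundary (R.mark 0)
    rw [sub_add_cancel]
    exact R.periodic_boundary _
  refine ⟨R₂, rfl, fun u ↦ rfl, fun i ↦ rfl, ?_⟩
  intro φ x φ₂ x₂ h h₂
  -- `η(x₂) = 1 - η(x)` by the Möbius bookkeeping (`φ₂ : ℍₒ → Ω = R.carrier` definitionally)
  have hη : crossRatio x₂ = 1 - crossRatio x :=
    crossRatio_eq_one_sub_of_cyclic_boundaryValues R h φ₂ h₂.1 h₂.2 hp0 hp1 hp2 hp3
  have hmem := ConformalRectangle.crossRatio_mem_Ioo_of_isUniformizing h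
  rw [hη]
  exact cardyFunction_one_sub_holds ⟨hmem.1.le, hmem.2.le⟩

end Summit.CriticalPhenomena.CardyFormulaZ2.Cruxes.LoopsToCrossings.OracleSandwich
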